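import Literature.AlgebraicGeometry.Motives.GrassmannianChartAffine
import HarnessLib

/-!
# The chart coordinates are natural in the `R`-algebra: `coordMap (map f N) = f ∘ coordMap N`

Topic `Literature/AlgebraicGeometry/Motives`; namespace `Literature.AlgebraicGeometry.Motives`, prefix `Grassmannian.`.  Sequel to
`GrassmannianCharts` (C1)(C2) and `GrassmannianChartAffine` (C4); cell hodgecm-mathlib key (h4) (author B-p21 (g15), partner
B-p18 (g17)), deliverable (C4)-naturality.  THEOREMS ONLY (no definition, no instance, no notation, no `sorry`).

The bijection `chart x A ≃ {ψ : M →ₗ[R] Aᵏ // ψ ∘ x = e}` (★ `chartEquivCoordMaps`) is NATURAL in `A`: along an `R`-algebra map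
`f : A → B`, Mathlib's `Module.Grassmannian.map f` on the left corresponds to post-composition with `f` on the right.  Hence the chart
subfunctor `A ↦ chart x A` of `Module.Grassmannian.functor R M k` is isomorphic to the functor `A ↦ {ψ : M → Aᵏ // ψ ∘ x = e}` — for
`M = Rⁿ` the functor of points `A ↦ A^{k(n−k)}` of affine `k(n−k)`-space ([Stacks 089T], EGA I 9.7.4).

* `Grassmannian.liftBaseChange_compLeft_comp` — the `B`-linear extension of `f ∘ ψ` factors as
  `(B ⊗[A] (A⊗M)⧸ker ψ̃ ≅ Bᵏ) ∘ baseChangeMkQ`;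
* **`Grassmannian.map_ofCoordMap`** — `map f (N_ψ) = N_{f ∘ ψ}`;
* **`Grassmannian.coordMap_map`** — `coordMap x (map f N) = f ∘ coordMap x N`.

HC_CM is proved only modulo the 7 printed citations until rung 0 closes; nothing here is about HC.

## References
* [StacksProject, Tag 089T]; A. Grothendieck, EGA I (Springer 1971), §9.7.4; [EisenbudHarris2016, §3.2.2].
-/

set_option autoImplicit false

noncomputable section

universe u v w

open TensorProduct

namespace Literature.AlgebraicGeometry.Motives

namespace Grassmannian

variable {R : Type u} [CommRing R] {M : Type v} [AddCommGroup M] [Module R M] {k : ℕ}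
variable {A : Type w} [CommRing A] [Algebra R A] {B : Type w} [CommRing B] [Algebra R B]

/-- Post-composition with `f` preserves the frame normalisation `ψ(xᵢ) = eᵢ` (`f(1) = 1`, `f(0) = 0`). [cite: StacksProject, Tag 089T] -/
theorem compLeft_comp_frame (f : A →ₐ[R] B) (x : Fin k → M) (ψ : M →ₗ[R] (Fin k → A))
    (hψ : ∀ i, ψ (x i) = Pi.single i 1) (i : Fin k) :
    (f.toLinearMap.compLeft (Fin k) ∘ₗ ψ) (x i) = Pi.single i 1 := by
  rw [LinearMap.comp_apply, hψ]
  funext j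
  rw [LinearMap.compLeft_apply, Function.comp_apply, AlgHom.toLinearMap_apply, Pi.single_apply, Pi.single_apply, apply_ite f,
    map_one, map_zero]

/-- **The base change of a coordinate map factors through `baseChangeMkQ`**: the `B`-linear extension of `f ∘ ψ : M → Bᵏ` is
`(Bᵏ ≅ B ⊗[A] Aᵏ ≅ B ⊗[A] (A⊗M)⧸ker ψ̃)⁻¹`-composed with Mathlib's `baseChangeMkQ B (ker ψ̃) : B ⊗[R] M → B ⊗[A] ((A⊗M)⧸ker ψ̃)`.
[cite: StacksProject, Tag 089T] -/
theorem liftBaseChange_compLeft_comp (f : A →ₐ[R] B) (x : Fin k → M) (ψ : M →ₗ[R] (Fin k → A))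
    (hψ : ∀ i, ψ (x i) = Pi.single i 1) :
    letI : Algebra A B := f.toAlgebra
    letI : IsScalarTower R A B := IsScalarTower.of_algHom f
    (f.toLinearMap.compLeft (Fin k) ∘ₗ ψ).liftBaseChange B =
      ((((ψ.liftBaseChange A).quotKerEquivOfSurjective (liftBaseChange_surjective x ψ hψ)).baseChange A B _ _).trans
          (TensorProduct.piScalarRight A B B (Fin k))).toLinearMap ∘ₗ
        Module.Grassmannian.baseChangeMkQ B (LinearMap.ker (ψ.liftBaseChange A)) := by
  letI : Algebra A B := f.toAlgebra
  letI : IsScalarTower R A B := IsScalarTower.of_algHom f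
  refine TensorProduct.AlgebraTensorModule.ext fun b m => ?_
  rw [LinearMap.liftBaseChange_tmul, LinearMap.comp_apply, LinearMap.comp_apply, LinearEquiv.coe_toLinearMap,
    LinearEquiv.trans_apply]
  change _ = TensorProduct.piScalarRight A B B (Fin k)
    ((((ψ.liftBaseChange A).quotKerEquivOfSurjective (liftBaseChange_surjective x ψ hψ)).baseChange A B _ _)
      (((LinearMap.ker (ψ.liftBaseChange A)).mkQ.baseChange B)
        ((AlgebraTensorModule.cancelBaseChange R A B B M).symm (b ⊗ₜ[R] m))))
  rw [AlgebraTensorModule.cancelBaseChange_symm_tmul, LinearMap.baseChange_tmul, LinearEquiv.baseChange_tmul,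
    Submodule.mkQ_apply, LinearMap.quotKerEquivOfSurjective_apply_mk, LinearMap.liftBaseChange_tmul, one_smul,
    TensorProduct.piScalarRight_apply, TensorProduct.piScalarRightHom_tmul]
  funext j
  rw [Pi.smul_apply, LinearMap.compLeft_apply, Function.comp_apply, AlgHom.toLinearMap_apply, smul_eq_mul, Algebra.smul_def,
    mul_comm]
  rfl

/-- **`map f (N_ψ) = N_{f ∘ ψ}`**: Mathlib's base change of the chart point of a coordinate map is the chart point of the
post-composed coordinate map (both submodules of `B ⊗[R] M` are the kernel of the base-changed quotient map, up to the linear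
equivalence `B ⊗[A] Aᵏ ≅ Bᵏ`). [cite: StacksProject, Tag 089T] [cite: EisenbudHarris2016, §3.2.2] -/
theorem map_ofCoordMap (f : A →ₐ[R] B) (x : Fin k → M) (ψ : M →ₗ[R] (Fin k → A)) (hψ : ∀ i, ψ (x i) = Pi.single i 1) :
    Module.Grassmannian.map f (ofCoordMap x ψ hψ) =
      ofCoordMap x (f.toLinearMap.compLeft (Fin k) ∘ₗ ψ) (compLeft_comp_frame f x ψ hψ) := by
  letI : Algebra A B := f.toAlgebra
  letI : IsScalarTower R A B := IsScalarTower.of_algHom f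
  refine Module.Grassmannian.ext ?_
  rw [Module.Grassmannian.map_toSubmodule f (ofCoordMap x ψ hψ), ofCoordMap_toSubmodule, ofCoordMap_toSubmodule,
    liftBaseChange_compLeft_comp f x ψ hψ, LinearEquiv.ker_comp]

/-- **NATURALITY OF THE CHART COORDINATES**: `coordMap x (map f N) = f ∘ coordMap x N` — along `f : A → B`, Mathlib's
`Module.Grassmannian.map f` on `chart x` is post-composition with `f` on the coordinate maps `M → Aᵏ`; i.e. the bijections
★ `chartEquivCoordMaps x A` assemble to an isomorphism of functors `(A ↦ chart x A) ≅ (A ↦ {ψ : M → Aᵏ // ψ ∘ x = e})` on `R`-algebras.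
[cite: StacksProject, Tag 089T] [cite: EisenbudHarris2016, §3.2.2] -/
theorem coordMap_map (f : A →ₐ[R] B) (x : Fin k → M) (N : Module.Grassmannian A (A ⊗[R] M) k) (hN : N ∈ chart R M k x A) :
    coordMap x (Module.Grassmannian.map f N) (map_mem_chart f hN) = f.toLinearMap.compLeft (Fin k) ∘ₗ coordMap x N hN := by
  -- both sides are coordinate maps of the same chart point `map f N`
  have h1 : ofCoordMap x (f.toLinearMap.compLeft (Fin k) ∘ₗ coordMap x N hN)
      (compLeft_comp_frame f x _ (coordMap_frame x N hN)) = Module.Grassmannian.map f N := by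
    rw [← map_ofCoordMap f x (coordMap x N hN) (coordMap_frame x N hN), ofCoordMap_coordMap]
  have h2 := (chartEquivCoordMaps R M k x B).symm.injective
    (a₁ := ⟨coordMap x (Module.Grassmannian.map f N) (map_mem_chart f hN), coordMap_frame x _ _⟩)
    (a₂ := ⟨f.toLinearMap.compLeft (Fin k) ∘ₗ coordMap x N hN, compLeft_comp_frame f x _ (coordMap_frame x N hN)⟩)
    (Subtype.ext (by rw [chartEquivCoordMaps_symm_apply, chartEquivCoordMaps_symm_apply, ofCoordMap_coordMap, h1]))
  exact congrArg Subtype.val h2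

end Grassmannian

end Literature.AlgebraicGeometry.Motives

end
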